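/-
Copyright (c) 2026 the pub-hodgecm-mathlib formalisation cell (harness21).  Prover seat hodgecm-mathlib-K2Liu-p01 (g8), Track B «K2-LIT»,
#184♮ = hLiu418 = `stmt-HodgeConjecture-24832`; #42S organ S1 ROAD W, F7 frame (RULINGS «M-158a» (2), «M-158b»; LEAD BATCH #8 (4)); SPEC-F7-FrameStep §2 (ii)∕(iii):
the FRAME MATRIX `P` of the hyperbolic pair of ★ (ii-a) — `P·Dᵀ·σ(P)ᵀ = [[0,1,0],[1,0,0],[0,0,d_k]]` (the `hP` input of ★ K2Liu-p08 (g4) `K2LiuHermitianGramFrameChange.gram_eq_vecMulVec_of_frame`)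
and `P` invertible.
-/
import Summits.HodgeConjecture.HodgeConjecture.Theorems.K2LiuHyperbolicPairOfIsotropicNorm   -- ★ (ii-a) `herm_pair_pair`, `herm_pair_single_eq_zero`, `herm_single_single_self`
import Mathlib.LinearAlgebra.Matrix.NonsingularInverse
import Mathlib.Tactic.LinearCombination
import HarnessLib

/-!
# Crux `HLiu418`, #42S-S1 ROAD W, file (T3-frame-ii-c): THE HYPERBOLIC FRAME MATRIX — `P = [u; u′; e_k]`, `P·Dᵀ·σ(P)ᵀ = [[0,1,0],[1,0,0],[0,0,d_k]]`, `P` a unit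

Cell `hodgecm-mathlib`, crux item hLiu418 = `stmt-HodgeConjecture-24832` (helper lane `--supports … --as helper`, count-neutral).  THEOREMS ONLY (no `def`, no instance,
no notation, no named-fact hypothesis, no `sorry`).  GENERIC: field `K`, `σ : K →+* K`, `d : Fin 3 → K`, distinct `i j k : Fin 3`.

WHY.  ★ (ii-a) `exists_hyperbolic_pair` produces `u = p e_i + q e_j`, `u′ = p′e_i + q′e_j` with `h(u,u) = h(u′,u′) = 0`, `h(u,u′) = h(u′,u) = 1`, `pq′ − qp′ ≠ 0`
(`h(x,y) = Σ_c d_c x_c σ(y_c)`); ★ K2Liu-p08 (g4) `K2LiuHermitianGramFrameChange.gram_eq_vecMulVec_of_frame` turns ★ (T3a)'s frame Gram into ★ (T3-core)'s hyperbolic Gram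
GIVEN a frame matrix `P` with `P·Dᵀ·σ(P)ᵀ = [[0,1,0],[1,0,0],[0,0,d]]` and coordinates `b_j = a_j ᵥ* P`.  This file supplies that `P` — the Mathlib term
`Matrix.of ![e_i p + e_j q, e_i p′ + e_j q′, e_k 1]` (rows `u, u′, ℓ = e_k`) — and its invertibility (so `a_j := b_j ᵥ* P⁻¹` is a change of coordinates):
* `entry_eq` — `(P·Dᵀ·σ(P)ᵀ)_{rs} = h(row_r, row_s)`;   * **`frame_relation`** — the matrix identity (nine `h`-values: ★ (ii-a));
* **`vecMul_frame_injective`** (`a ᵥ* P = 0 ⇒ a = 0`, coordinates at `i, j, k` and `pq′ − qp′ ≠ 0`), **`isUnit_frame`** (Mathlib `Matrix.vecMul_injective_iff_isUnit`),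
  `vecMul_frame_nonsing_inv` (`(b ᵥ* P⁻¹) ᵥ* P = b`).
[Shimura1997, §13.2] [Scharlau1985HermitianForms, Ch. 7 §1] [Jacobowitz1962, §4].
HONEST LABEL.  Count-neutral helper; `HC_CM` is proved only modulo the 7 printed citations (2 remaining named inputs: hLiu418 = `stmt-HodgeConjecture-24832`,
h413 = `stmt-HodgeConjecture-24833`) until rung 0 closes.

## References
* [Shimura1997] G. Shimura, *Euler Products and Eisenstein Series*, CBMS 93 (1997), §13.2.
* [Scharlau1985HermitianForms] W. Scharlau, *Quadratic and Hermitian Forms*, Grundlehren 270 (1985), Ch. 7 §1.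
* [Jacobowitz1962] R. Jacobowitz, *Hermitian forms over local fields*, Amer. J. Math. 84 (1962), §4.
-/

set_option autoImplicit false
set_option linter.dupNamespace false -- the mandated namespace repeats `HodgeConjecture.HodgeConjecture`

open Finset Matrix

namespace Summit.HodgeConjecture.HodgeConjecture.Cruxes.HLiu418.K2LiuHyperbolicFrameMatrix

open K2LiuHyperbolicPairOfIsotropicNorm

variable {K : Type*} [Field K] (σ : K →+* K) (d : Fin 3 → K)

/-! ## §1 Entries of `P·Dᵀ·σ(P)ᵀ` -/

/-- `(P·Dᵀ·σ(P)ᵀ)_{rs} = Σ_c d_c P_{rc} σ(P_{sc}) = h(row_r P, row_s P)`. [cite: Scharlau1985HermitianForms, Ch. 7 §1] -/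
theorem entry_eq (P : Matrix (Fin 3) (Fin 3) K) (r s : Fin 3) :
    (P * (diagonal d)ᵀ * (P.map σ)ᵀ) r s = ∑ c, d c * P r c * σ (P s c) := by
  rw [mul_apply]
  refine Finset.sum_congr rfl fun c _ => ?_
  rw [transpose_apply, map_apply, diagonal_transpose, mul_diagonal]
  ring

/-! ## §2 The frame relation -/

/-- **THE FRAME RELATION**: for the rows `u = e_i p + e_j q`, `u′ = e_i p′ + e_j q′`, `ℓ = e_k` (`i, j, k` distinct) with `h(u,u) = h(u′,u′) = 0`, `h(u,u′) = h(u′,u) = 1`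
(★ (ii-a) `exists_hyperbolic_pair`): `P·Dᵀ·σ(P)ᵀ = [[0,1,0],[1,0,0],[0,0,d_k]]`. [cite: Shimura1997, §13.2] [cite: Jacobowitz1962, §4] -/
theorem frame_relation {i j k : Fin 3} (hki : k ≠ i) (hkj : k ≠ j) {p q p' q' : K}
    (huu : (∑ c, d c * ((Pi.single i p : Fin 3 → K) + (Pi.single j q : Fin 3 → K)) c * σ (((Pi.single i p : Fin 3 → K) + (Pi.single j q : Fin 3 → K)) c)) = 0)
    (hu'u' : (∑ c, d c * ((Pi.single i p' : Fin 3 → K) + (Pi.single j q' : Fin 3 → K)) c * σ (((Pi.single i p' : Fin 3 → K) + (Pi.single j q' : Fin 3 → K)) c)) = 0)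
    (huu' : (∑ c, d c * ((Pi.single i p : Fin 3 → K) + (Pi.single j q : Fin 3 → K)) c * σ (((Pi.single i p' : Fin 3 → K) + (Pi.single j q' : Fin 3 → K)) c)) = 1)
    (hu'u : (∑ c, d c * ((Pi.single i p' : Fin 3 → K) + (Pi.single j q' : Fin 3 → K)) c * σ (((Pi.single i p : Fin 3 → K) + (Pi.single j q : Fin 3 → K)) c)) = 1) :
    Matrix.of ![(Pi.single i p : Fin 3 → K) + Pi.single j q, (Pi.single i p' : Fin 3 → K) + Pi.single j q', Pi.single k 1] * (diagonal d)ᵀ *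
        ((Matrix.of ![(Pi.single i p : Fin 3 → K) + Pi.single j q, (Pi.single i p' : Fin 3 → K) + Pi.single j q', Pi.single k 1]).map σ)ᵀ =
      !![0, 1, 0; 1, 0, 0; 0, 0, d k] := by
  have h02 := (herm_pair_single_eq_zero σ d hki hkj p q (1 : K)).1
  have h20 := (herm_pair_single_eq_zero σ d hki hkj p q (1 : K)).2
  have h12 := (herm_pair_single_eq_zero σ d hki hkj p' q' (1 : K)).1
  have h21 := (herm_pair_single_eq_zero σ d hki hkj p' q' (1 : K)).2
  have h22 := herm_single_single_self σ d k
  ext r s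
  rw [entry_eq]
  fin_cases r <;> fin_cases s <;>
    simp only [of_apply, cons_val', cons_val_zero, cons_val_one, cons_val_two, empty_val', cons_val_fin_one, Nat.succ_eq_add_one, Nat.reduceAdd,
      tail_cons, head_cons, head_fin_const, Fin.zero_eta, Fin.mk_one, Fin.reduceFinMk, Fin.isValue] <;>
    first | exact huu | exact huu' | exact h02 | exact hu'u | exact hu'u' | exact h12 | exact h20 | exact h21 | exact h22

/-! ## §3 Invertibility -/

/-- coordinates of `a ᵥ* P` at `i`, `j`, `k`: `a₀p + a₁p′`, `a₀q + a₁q′`, `a₂`. [folklore] -/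
theorem vecMul_frame_apply {i j k : Fin 3} (hij : i ≠ j) (hki : k ≠ i) (hkj : k ≠ j) (p q p' q' : K) (a : Fin 3 → K) :
    (a ᵥ* Matrix.of ![(Pi.single i p : Fin 3 → K) + Pi.single j q, (Pi.single i p' : Fin 3 → K) + Pi.single j q', Pi.single k 1]) i = a 0 * p + a 1 * p' ∧
    (a ᵥ* Matrix.of ![(Pi.single i p : Fin 3 → K) + Pi.single j q, (Pi.single i p' : Fin 3 → K) + Pi.single j q', Pi.single k 1]) j = a 0 * q + a 1 * q' ∧
    (a ᵥ* Matrix.of ![(Pi.single i p : Fin 3 → K) + Pi.single j q, (Pi.single i p' : Fin 3 → K) + Pi.single j q', Pi.single k 1]) k = a 2 := by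
  simp only [vecMul, dotProduct, Fin.sum_univ_three, of_apply, cons_val_zero, cons_val_one, cons_val_two, head_cons, Nat.succ_eq_add_one, Nat.reduceAdd, tail_cons,
    Pi.add_apply, Pi.single_eq_same, Pi.single_eq_of_ne hij.symm, Pi.single_eq_of_ne hij, Pi.single_eq_of_ne hki.symm, Pi.single_eq_of_ne hkj.symm,
    Pi.single_eq_of_ne hki, Pi.single_eq_of_ne hkj]
  refine ⟨by ring, by ring, by ring⟩

/-- **`a ᵥ* P` is injective** when `pq′ − qp′ ≠ 0`. [cite: Jacobowitz1962, §4] -/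
theorem vecMul_frame_injective {i j k : Fin 3} (hij : i ≠ j) (hki : k ≠ i) (hkj : k ≠ j) {p q p' q' : K} (hdet : p * q' - q * p' ≠ 0) :
    Function.Injective fun a : Fin 3 → K =>
      a ᵥ* Matrix.of ![(Pi.single i p : Fin 3 → K) + Pi.single j q, (Pi.single i p' : Fin 3 → K) + Pi.single j q', Pi.single k 1] := by
  -- a linear map: injective iff trivial kernel
  intro a b hab
  have hsub : (a - b) ᵥ* Matrix.of ![(Pi.single i p : Fin 3 → K) + Pi.single j q, (Pi.single i p' : Fin 3 → K) + Pi.single j q', Pi.single k 1] = 0 := by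
    rw [sub_vecMul]
    exact sub_eq_zero.2 hab
  obtain ⟨hi, hj, hk⟩ := vecMul_frame_apply hij hki hkj p q p' q' (a - b)
  rw [hsub, Pi.zero_apply] at hi hj hk
  have h0 : (a - b) 0 * (p * q' - q * p') = 0 := by linear_combination q' * hi.symm - p' * hj.symm
  have h1 : (a - b) 1 * (p * q' - q * p') = 0 := by linear_combination (-q) * hi.symm + p * hj.symm
  have e0 : (a - b) 0 = 0 := (mul_eq_zero.1 h0).resolve_right hdet
  have e1 : (a - b) 1 = 0 := (mul_eq_zero.1 h1).resolve_right hdet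
  have e2 : (a - b) 2 = 0 := hk.symm
  rw [← sub_eq_zero]
  funext c
  fin_cases c
  · exact e0
  · exact e1
  · exact e2

/-- **the frame matrix is a unit.** [cite: Jacobowitz1962, §4] -/
theorem isUnit_frame {i j k : Fin 3} (hij : i ≠ j) (hki : k ≠ i) (hkj : k ≠ j) {p q p' q' : K} (hdet : p * q' - q * p' ≠ 0) :
    IsUnit (Matrix.of ![(Pi.single i p : Fin 3 → K) + Pi.single j q, (Pi.single i p' : Fin 3 → K) + Pi.single j q', Pi.single k 1]) :=
  Matrix.vecMul_injective_iff_isUnit.1 (vecMul_frame_injective hij hki hkj hdet)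

/-- change of coordinates round trip: `(b ᵥ* P⁻¹) ᵥ* P = b` and `(a ᵥ* P) ᵥ* P⁻¹ = a`. [folklore] -/
theorem vecMul_frame_nonsing_inv {i j k : Fin 3} (hij : i ≠ j) (hki : k ≠ i) (hkj : k ≠ j) {p q p' q' : K} (hdet : p * q' - q * p' ≠ 0) (a b : Fin 3 → K) :
    (b ᵥ* (Matrix.of ![(Pi.single i p : Fin 3 → K) + Pi.single j q, (Pi.single i p' : Fin 3 → K) + Pi.single j q', Pi.single k 1])⁻¹) ᵥ*
        Matrix.of ![(Pi.single i p : Fin 3 → K) + Pi.single j q, (Pi.single i p' : Fin 3 → K) + Pi.single j q', Pi.single k 1] = b ∧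
    (a ᵥ* Matrix.of ![(Pi.single i p : Fin 3 → K) + Pi.single j q, (Pi.single i p' : Fin 3 → K) + Pi.single j q', Pi.single k 1]) ᵥ*
        (Matrix.of ![(Pi.single i p : Fin 3 → K) + Pi.single j q, (Pi.single i p' : Fin 3 → K) + Pi.single j q', Pi.single k 1])⁻¹ = a := by
  have hU := (Matrix.isUnit_iff_isUnit_det _).1 (isUnit_frame hij hki hkj hdet)
  exact ⟨by rw [vecMul_vecMul, nonsing_inv_mul _ hU, vecMul_one], by rw [vecMul_vecMul, mul_nonsing_inv _ hU, vecMul_one]⟩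

end Summit.HodgeConjecture.HodgeConjecture.Cruxes.HLiu418.K2LiuHyperbolicFrameMatrix
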